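import Literature.Computability.AlgebraicComplexity.LocalStrongUSP
import Mathlib.Data.Fintype.Perm
import Mathlib.Logic.Equiv.Fin.Basic
import Mathlib.Data.Finset.Powerset
import Mathlib.Algebra.BigOperators.Fin
import Mathlib.Data.Nat.Choose.Basic
import Mathlib.Data.Fintype.Powerset
import HarnessLib

/-!
# Uniquely solvable puzzles (USPs), strong USPs, and CKSU's reduction of strong USPs to LOCAL strong
USPs (Cohn–Kleinberg–Szegedy–Umans 2005, §3 and Proposition 6.3)

Topic `Literature/Computability/AlgebraicComplexity` (group-theoretic matrix multiplication).
Companion of `LocalStrongUSP.lean`, whose module docstring lists as NOT formalised there: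
"strong USPs and USPs proper (CKSU Defs. §3), Lemma 32 'every local strong USP is a strong USP'".
This file supplies exactly those, following the FOCS 2005 paper of Cohn, Kleinberg, Szegedy and
Umans (arXiv:math/0511460; FOCS numbering / consecutive arXiv numbering given as `FOCS / arXiv`):

* `IsUSP`, `IsStrongUSP` — the definitions of §3 ("USPs and strong USPs", arXiv text p. 5), for a
  puzzle given as an indexed family `row : Fin s → Fin k → Fin 3` of `s` rows of width `k` over the
  alphabet `{1,2,3}` coded `{0,1,2}` (as in `IsLocalStrongUSP`).  AS PRINTED: "A uniquely solvable
  puzzle (USP) of width `k` is a subset `U ⊆ {1,2,3}^k` satisfying the following property: For all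
  permutations `π₁, π₂, π₃ ∈ Sym(U)`, either `π₁ = π₂ = π₃` or else there exist `u ∈ U` and
  `i ∈ [k]` such that at least two of `(π₁(u))ᵢ = 1`, `(π₂(u))ᵢ = 2`, and `(π₃(u))ᵢ = 3` hold."
  and "A strong USP is a USP in which the defining property is strengthened as follows: … such that
  exactly two of `(π₁(u))ᵢ = 1`, `(π₂(u))ᵢ = 2`, and `(π₃(u))ᵢ = 3` hold."  With rows indexed by
  `Fin s` and `Sym(U)` read as `Equiv.Perm (Fin s)`, a family with two equal rows is never a strong
  USP (`IsStrongUSP.injective`), so `IsStrongUSP row` says precisely that the SET of rows is a strong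
  USP of size `s` in CKSU's sense (= Anderson–Ji–Xu, arXiv:2301.00074v1 §2 Def. 1 "(s,k)-puzzle =
  set of s rows" + Def. 3 "Strong USP").
* `IsStrongUSP.isUSP` (immediate) and `IsLocalStrongUSP.isStrongUSP` = **Lemma 6.1 / 32** ("Every
  local strong USP is a strong USP"), proved as printed.
* `isStrongUSP_iff_fix_first` — the reduction "we fix `π₁ = 1`" (Anderson–Ji–Xu, arXiv:2301.00074v1
  §3.1, remark after Algorithm 1: re-index `u` by `π₁`), proved.
* **Proposition 6.3 / 34** ("The strong USP capacity is achieved by local strong USPs. In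
  particular, given any strong USP `U` of width `k`, there exists a local strong USP of size `|U|!`
  and width `|U|k`."), second sentence, proved by the printed construction: the rows of the new
  puzzle are indexed by `π ∈ Sym(U)` and the row `U_π` is the concatenation of
  `π(u₁), …, π(u_{|U|})` (`strongUSPBlowup`; `IsStrongUSP.isLocalStrongUSP_blowup` for any
  injective indexing of permutations and any surjective indexing of the `|U|·k` coordinates, and the
  `Fin`-indexed existence statement `IsStrongUSP.exists_isLocalStrongUSP` with sizes `s !` and
  `s * k`).  The first sentence (about the strong USP CAPACITY, a `limsup`) is not stated here: the
  tree has no USP-capacity vocabulary. TODO(general form): strong USP capacity (CKSU §3) and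
  "capacity achieved by local strong USPs".

* **The size of a USP** (section `USPSize`): `IsUSP.uspPiece_injective` = Anderson–Ji–Xu Lemma 6
  ("Implicit in [cksu05]": the `e`-pieces of distinct rows differ — the core of CKSU Lemma 3.2 / 12),
  the unique-pieces bound `IsUSP.card_le_two_pow` (`s ≤ 2^k`), and Anderson–Ji–Xu §5 Proposition 2
  (the "USP bound") `IsUSP.card_le_uspSizeBound : s ≤ uspSizeBound k` with
  `uspSizeBound k = Σ_{c₁+c₂≤k} min(binom(k,c₁), binom(k,c₂), binom(k,k−c₁−c₂))`, whose values for
  `k = 1…12` (`uspSizeBound_values`) are the 'USP' row `3 6 12 24 45 87 168 312 597 1140 2112 4023`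
  of their Table 2, all PROVED.

* **Downward closure** (section `Downward`): Anderson–Ji–Xu Lemma 5 ("If `P` is a strong USP, then so
  is every subpuzzle") as `IsStrongUSP.restrict` (and `IsUSP.restrict`), proved as printed via
  `Equiv.Perm.extendDomain`.

* **Two symbols per coordinate** (section `TwoSymbols`): CKSU §3.4 — a USP in which every column misses a
  symbol is a strong USP (`IsUSP.isStrongUSP_of_twoSymbols`).

* **Puzzle symmetry** (section `Symmetry`): Anderson–Ji–Xu §4.1 Lemma 8 — strong-USP-ness (and USP-ness) is
  invariant under reordering rows (`isStrongUSP_rowPerm_iff`), reordering columns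
  (`isStrongUSP_colPerm_iff`) and relabelling the three symbols (`isStrongUSP_symbolPerm_iff`, via the
  re-slotting `π'_a = π_{δ⁻¹ a}` of the three permutations); `AndersonJiXu2020_lemma8` as printed and the
  combined `isStrongUSP_relabel_iff`.

Why this matters downstream (not proved in THIS file, which imports nothing from `Summits/`): with
the tree's PROVED Theorem 6.2 / 33 (`CohnKleinbergSzegedyUmans2005_thm33_holds`: local strong USP ⇒
STPP family in `Cyc_ℓ^k`) and Theorem 5.5 (abelian case, proved), Proposition 34 turns CKSU's
Corollary 3.6 / 16 — "`ω ≤ 3 log m / log(m−1) − 3 log(|U|!)/(|U| k log(m−1))` for every strong USP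
`U` of width `k` and every `m ≥ 3`" (= Anderson–Ji–Xu 2020, Lemma 1) — into a theorem; that
assembly is census-side (`Summits/MatrixMultiplication/OmegaCensus/StrongUSPOmegaBound.lean`).

## References
* H. Cohn, R. Kleinberg, B. Szegedy, C. Umans, *Group-theoretic algorithms for matrix
  multiplication*, FOCS 2005, 379–388; arXiv:math/0511460 (§3 p. 5: USP / strong USP; §6.1 p. 10:
  Lemma 32, Theorem 33, Proposition 34). [CohnKleinbergSzegedyUmans2005]
* M. Anderson, Z. Ji, A. Y. Xu, *Matrix multiplication: verifying strong uniquely solvable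
  puzzles*, SAT 2020, LNCS 12178, 464–480; full version arXiv:2301.00074v1 (§2 Def. 1–4, Lemma 1
  = CKSU Cor. 3.6, Prop. 1 = CKSU Prop. 6.3; §3.1 Algorithm 1). [AndersonJiXu2020]
-/

namespace Literature.Computability.AlgebraicComplexity

open Equiv

/-! ## The two coordinate predicates of CKSU §3 (symbols `1,2,3` coded `0,1,2`) -/

/-- "at least two of `a = 1`, `b = 2`, `c = 3` hold" (symbols coded `0, 1, 2`) — the coordinate
condition in the definition of a USP. [cite: CohnKleinbergSzegedyUmans2005, §3 (p. 5), definition of a USP] -/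
def USPAtLeastTwo (a b c : Fin 3) : Prop :=
  (a = 0 ∧ b = 1) ∨ (a = 0 ∧ c = 2) ∨ (b = 1 ∧ c = 2)

/-- "exactly two of `a = 1`, `b = 2`, `c = 3` hold" (symbols coded `0, 1, 2`) — the coordinate
condition in the definition of a strong USP.
[cite: CohnKleinbergSzegedyUmans2005, §3 (p. 5), definition of a strong USP] -/
def USPExactlyTwo (a b c : Fin 3) : Prop :=
  (a = 0 ∧ b = 1 ∧ c ≠ 2) ∨ (a = 0 ∧ b ≠ 1 ∧ c = 2) ∨ (a ≠ 0 ∧ b = 1 ∧ c = 2)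

/-- Decidability of the "at least two" coordinate condition (plumbing for `decide`). [folklore] -/
instance USPAtLeastTwo.instDecidable (a b c : Fin 3) : Decidable (USPAtLeastTwo a b c) := by
  unfold USPAtLeastTwo; infer_instance

/-- Decidability of the "exactly two" coordinate condition (plumbing for `decide`). [folklore] -/
instance USPExactlyTwo.instDecidable (a b c : Fin 3) : Decidable (USPExactlyTwo a b c) := by
  unfold USPExactlyTwo; infer_instance

/-- "exactly two" implies "at least two". [folklore] -/
private theorem USPExactlyTwo.atLeastTwo {a b c : Fin 3} (h : USPExactlyTwo a b c) :
    USPAtLeastTwo a b c := by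
  rcases h with ⟨h0, h1, -⟩ | ⟨h0, -, h2⟩ | ⟨-, h1, h2⟩
  · exact Or.inl ⟨h0, h1⟩
  · exact Or.inr (Or.inl ⟨h0, h2⟩)
  · exact Or.inr (Or.inr ⟨h1, h2⟩)

/-- The "exactly two" condition is membership in the six-pattern set of `LocalStrongUSP.lean`
(`{(1,2,1),(1,2,2),(1,1,3),(1,3,3),(2,2,3),(3,2,3)}`). [cite: CohnKleinbergSzegedyUmans2005, §6.1 (p. 10)] -/
theorem uspExactlyTwo_iff_mem_localStrongUSPPatterns (a b c : Fin 3) :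
    USPExactlyTwo a b c ↔ (a, b, c) ∈ localStrongUSPPatterns :=
  (mem_localStrongUSPPatterns_iff a b c).symm

/-- No symbol satisfies "exactly two of `x = 1`, `x = 2`, `x = 3`". [folklore] -/
private theorem not_uspExactlyTwo_self (x : Fin 3) : ¬ USPExactlyTwo x x x := by
  revert x; decide

/-! ## USPs and strong USPs (CKSU 2005 §3) -/

/-- **Uniquely solvable puzzle (USP)** of `s` rows and width `k` (Cohn–Kleinberg–Szegedy–Umans 2005,
§3, AS PRINTED: "For all permutations `π₁, π₂, π₃ ∈ Sym(U)`, either `π₁ = π₂ = π₃` or else there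
exist `u ∈ U` and `i ∈ [k]` such that at least two of `(π₁(u))ᵢ = 1`, `(π₂(u))ᵢ = 2`, and
`(π₃(u))ᵢ = 3` hold"), for the puzzle `row : Fin s → Fin k → Fin 3` (symbols `1,2,3` coded
`0,1,2`; `Sym(U)` = `Equiv.Perm (Fin s)`; = Anderson–Ji–Xu, arXiv:2301.00074v1 §2, Definition 2).
[cite: CohnKleinbergSzegedyUmans2005, §3 (p. 5), definition of a USP] -/
def IsUSP {s k : ℕ} (row : Fin s → Fin k → Fin 3) : Prop :=
  ∀ π₁ π₂ π₃ : Perm (Fin s), (π₁ = π₂ ∧ π₂ = π₃) ∨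
    ∃ u : Fin s, ∃ i : Fin k, USPAtLeastTwo (row (π₁ u) i) (row (π₂ u) i) (row (π₃ u) i)

/-- **Strong uniquely solvable puzzle (strong USP)** of `s` rows and width `k`
(Cohn–Kleinberg–Szegedy–Umans 2005, §3, AS PRINTED: "A strong USP is a USP in which the defining
property is strengthened as follows: For all permutations `π₁, π₂, π₃ ∈ Sym(U)`, either
`π₁ = π₂ = π₃` or else there exist `u ∈ U` and `i ∈ [k]` such that exactly two of `(π₁(u))ᵢ = 1`,
`(π₂(u))ᵢ = 2`, and `(π₃(u))ᵢ = 3` hold."), for the puzzle `row : Fin s → Fin k → Fin 3`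
(= Anderson–Ji–Xu, arXiv:2301.00074v1 §2, Definition 3 "Strong USP (SUSP)", for the SET of rows —
see `IsStrongUSP.injective`). [cite: CohnKleinbergSzegedyUmans2005, §3 (p. 5), definition of a strong USP] -/
def IsStrongUSP {s k : ℕ} (row : Fin s → Fin k → Fin 3) : Prop :=
  ∀ π₁ π₂ π₃ : Perm (Fin s), (π₁ = π₂ ∧ π₂ = π₃) ∨
    ∃ u : Fin s, ∃ i : Fin k, USPExactlyTwo (row (π₁ u) i) (row (π₂ u) i) (row (π₃ u) i)

/-- "A strong USP is a USP in which the defining property is strengthened": every strong USP is a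
USP. [cite: CohnKleinbergSzegedyUmans2005, §3 (p. 5)] -/
theorem IsStrongUSP.isUSP {s k : ℕ} {row : Fin s → Fin k → Fin 3} (h : IsStrongUSP row) :
    IsUSP row := by
  intro π₁ π₂ π₃
  rcases h π₁ π₂ π₃ with heq | ⟨u, i, hx⟩
  · exact Or.inl heq
  · exact Or.inr ⟨u, i, hx.atLeastTwo⟩

/-- **WLOG `π₁ = id`** (Anderson–Ji–Xu, arXiv:2301.00074v1 §3.1, Algorithm 1 and the remark after
it, AS PRINTED: "Observe that Algorithm 1 does not refer to the `π₁` of Definition 3. This is because the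
strong USP property is invariant to permutations of the rows and so `π₁` can be thought of as an
arbitrary phase. Hence, we fix `π₁ = 1`"): the strong-USP condition for `(π₁, π₂, π₃)` is the
condition for `(1, π₂ π₁⁻¹, π₃ π₁⁻¹)` after re-indexing `u ↦ π₁ u`, so it suffices to test the pairs
`(π₂, π₃) ≠ (1, 1)` against `π₁ = 1` (`(s!)²` instead of `(s!)³` cases for `decide`).
[cite: AndersonJiXu2020, §3.1 (Algorithm 1: "we fix π₁ = 1"; arXiv:2301.00074v1)] -/
theorem isStrongUSP_iff_fix_first {s k : ℕ} (row : Fin s → Fin k → Fin 3) :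
    IsStrongUSP row ↔ ∀ π₂ π₃ : Perm (Fin s), (π₂ = 1 ∧ π₃ = 1) ∨
      ∃ u : Fin s, ∃ i : Fin k, USPExactlyTwo (row u i) (row (π₂ u) i) (row (π₃ u) i) := by
  constructor
  · intro h π₂ π₃
    rcases h 1 π₂ π₃ with ⟨h12, h23⟩ | ⟨u, i, hx⟩
    · exact Or.inl ⟨h12.symm, (h12.trans h23).symm⟩
    · exact Or.inr ⟨u, i, by simpa using hx⟩
  · intro h π₁ π₂ π₃
    rcases h (π₂ * π₁⁻¹) (π₃ * π₁⁻¹) with ⟨h2, h3⟩ | ⟨u, i, hx⟩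
    · left
      rw [mul_inv_eq_one] at h2 h3
      exact ⟨h2.symm, h2.trans h3.symm⟩
    · right
      refine ⟨π₁⁻¹ u, i, ?_⟩
      simpa [Perm.mul_apply] using hx

/-- A strong USP (as an indexed family) has pairwise distinct rows: transposing two equal rows is a
permutation `π₁ ≠ 1 = π₂ = π₃` fixing every row VALUE, and no symbol satisfies "exactly two of
`x = 1, x = 2, x = 3`".  So `IsStrongUSP row` is CKSU's set condition for the `s`-element set of
rows. [cite: CohnKleinbergSzegedyUmans2005, §3 (p. 5)] -/
theorem IsStrongUSP.injective {s k : ℕ} {row : Fin s → Fin k → Fin 3} (h : IsStrongUSP row) :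
    Function.Injective row := by
  intro a b hab
  by_contra hne
  rcases h (swap a b) 1 1 with ⟨h1, -⟩ | ⟨u, i, hx⟩
  · exact hne (swap_eq_one_iff.mp h1)
  · have hrow : row (swap a b u) = row u := by
      rcases eq_or_ne u a with rfl | hua
      · rw [swap_apply_left]; exact hab.symm
      rcases eq_or_ne u b with rfl | hub
      · rw [swap_apply_right]; exact hab
      · rw [swap_apply_of_ne_of_ne hua hub]
    rw [hrow] at hx
    exact not_uspExactlyTwo_self _ (by simpa using hx)

/-- **Cohn–Kleinberg–Szegedy–Umans 2005, Lemma 6.1 / 32** ("Every local strong USP is a strong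
USP."), proved as printed: if `π₁, π₂, π₃` are not all equal, some `u` has `π₁ u, π₂ u, π₃ u` not
all equal, and the local condition at that triple of rows gives the coordinate.
[cite: CohnKleinbergSzegedyUmans2005, Lemma 32 (§6.1, p. 10)] -/
theorem IsLocalStrongUSP.isStrongUSP {s k : ℕ} {row : Fin s → Fin k → Fin 3}
    (h : IsLocalStrongUSP row) : IsStrongUSP row := by
  intro π₁ π₂ π₃
  by_cases heq : π₁ = π₂ ∧ π₂ = π₃
  · exact Or.inl heq
  right
  -- some `u` with `π₁ u, π₂ u, π₃ u` not all equal
  obtain ⟨u, hu⟩ : ∃ u : Fin s, π₁ u ≠ π₂ u ∨ π₂ u ≠ π₃ u := by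
    by_contra hall
    simp only [not_exists, not_or, not_not] at hall
    exact heq ⟨Equiv.ext fun u => (hall u).1, Equiv.ext fun u => (hall u).2⟩
  obtain ⟨i, hi⟩ := h (π₁ u) (π₂ u) (π₃ u) hu
  exact ⟨u, i, (uspExactlyTwo_iff_mem_localStrongUSPPatterns _ _ _).mpr hi⟩

/-! ## Proposition 6.3 / 34: a strong USP of size `s` and width `k` gives a local strong USP of
size `s!` and width `s·k` -/

/-- CKSU's blow-up of a puzzle (proof of Prop. 34): the row indexed by a permutation `π` of the rows
is "the concatenation of `π(u₁), π(u₂), …, π(u_s)`", i.e. its entry in the coordinate `(u, i)` is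
`(π u)ᵢ`. [cite: CohnKleinbergSzegedyUmans2005, Proposition 34 (§6.1, p. 10), proof] -/
def strongUSPBlowup {s k : ℕ} (row : Fin s → Fin k → Fin 3) (π : Perm (Fin s)) (c : Fin s × Fin k) :
    Fin 3 :=
  row (π c.1) c.2

/-- Unfolding lemma for `strongUSPBlowup`. [folklore] -/
@[simp] private theorem strongUSPBlowup_apply {s k : ℕ} (row : Fin s → Fin k → Fin 3) (π : Perm (Fin s))
    (u : Fin s) (i : Fin k) : strongUSPBlowup row π (u, i) = row (π u) i := rfl

/-- **Cohn–Kleinberg–Szegedy–Umans 2005, Proposition 6.3 / 34, the construction** (AS PRINTED: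
"fix an arbitrary ordering `u₁, …, u_{|U|}` of the elements of `U`. For each `π ∈ Sym(U)`, let
`U_π ∈ {1,2,3}^{|U|k}` be the concatenation of `π(u₁), π(u₂), …, π(u_{|U|})`. Then the set of all
vectors `U_π` is a local strong USP"): for a strong USP `row`, ANY injectively indexed family of the
blow-up rows `U_π`, with the `|U|·k` coordinates listed (surjectively) in any order, is a local strong
USP.  Proof as printed: for `π₁, π₂, π₃` not all equal the strong-USP coordinate `(u, i)` carries
one of the six admissible patterns. [cite: CohnKleinbergSzegedyUmans2005, Proposition 34 (§6.1, p. 10)] -/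
theorem IsStrongUSP.isLocalStrongUSP_blowup {s k : ℕ} {row : Fin s → Fin k → Fin 3}
    (h : IsStrongUSP row) {L K : ℕ} (e : Fin L → Perm (Fin s)) (he : Function.Injective e)
    (f : Fin K → Fin s × Fin k) (hf : Function.Surjective f) :
    IsLocalStrongUSP (fun a j => strongUSPBlowup row (e a) (f j)) := by
  intro a b c habc
  have hne : ¬(e a = e b ∧ e b = e c) := by
    rintro ⟨hab, hbc⟩
    rcases habc with hab' | hbc'
    · exact hab' (he hab)
    · exact hbc' (he hbc)
  rcases h (e a) (e b) (e c) with heq | ⟨u, i, hx⟩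
  · exact absurd heq hne
  · obtain ⟨j, hj⟩ := hf (u, i)
    refine ⟨j, ?_⟩
    show (strongUSPBlowup row (e a) (f j), strongUSPBlowup row (e b) (f j),
      strongUSPBlowup row (e c) (f j)) ∈ localStrongUSPPatterns
    rw [hj]
    exact (uspExactlyTwo_iff_mem_localStrongUSPPatterns _ _ _).mp hx

/-- **Cohn–Kleinberg–Szegedy–Umans 2005, Proposition 6.3 / 34** (second sentence, AS PRINTED: "given
any strong USP `U` of width `k`, there exists a local strong USP of size `|U|!` and width `|U|k`"):
a strong USP of `s` rows and width `k` yields a local strong USP of `s!` rows and width `s·k`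
(rows `U_π`, `π ∈ Sym(Fin s) ≃ Fin s!`; coordinates `Fin s × Fin k ≃ Fin (s·k)`).
[cite: CohnKleinbergSzegedyUmans2005, Proposition 34 (§6.1, p. 10)] -/
theorem IsStrongUSP.exists_isLocalStrongUSP {s k : ℕ} {row : Fin s → Fin k → Fin 3}
    (h : IsStrongUSP row) :
    ∃ row' : Fin (Nat.factorial s) → Fin (s * k) → Fin 3, IsLocalStrongUSP row' := by
  classical
  have hcard : Fintype.card (Perm (Fin s)) = Nat.factorial s := by
    rw [Fintype.card_perm, Fintype.card_fin]
  let e : Fin (Nat.factorial s) ≃ Perm (Fin s) := (Fintype.equivFinOfCardEq hcard).symm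
  let f : Fin (s * k) ≃ Fin s × Fin k := finProdFinEquiv.symm
  exact ⟨_, h.isLocalStrongUSP_blowup e e.injective f f.surjective⟩

/-! ## The size of a USP: "unique pieces" (AJX Lemma 6) and the USP bound (CKSU Lemma 12 / AJX Prop. 2)

Cohn–Kleinberg–Szegedy–Umans 2005, Lemma 3.2 / 12 ("The USP capacity is at most `3/2^{2/3}`") is proved
by: "If two elements of `U` have the symbol `1` in exactly the same locations, then letting `π₁` interchange
them would violate the definition of a USP, and of course the same holds for `2` or `3`. Thus
`|U_{n₁,n₂,n₃}| ≤ minᵢ binom(k, nᵢ)`", where `U_{n₁,n₂,n₃}` is the set of rows with `nᵢ` entries equal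
to `i`.  Anderson–Ji–Xu (arXiv:2301.00074v1) spell out the two finite statements this contains:
Lemma 6 ("Implicit in [cksu05]": distinct rows of a USP have distinct `e`-pieces for every `e ∈ [3]`;
hence the "unique pieces bound" `s ≤ 2^k` of their §5) and §5 Proposition 2 (the "USP bound"
`s ≤ Σ_{c₁=0}^{k} Σ_{c₂=0}^{k−c₁} min(binom(k,c₁), binom(k,c₂), binom(k,k−(c₁+c₂)))`, whose values
`3, 6, 12, 24, 45, 87, 168, 312, 597, 1140, 2112, 4023` for `k = 1…12` form the 'USP' row of their
Table 2).  Both are proved here for the tree's `IsUSP` (hence for `IsStrongUSP`). -/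

section USPSize

open Finset

variable {s k : ℕ}

/-- The `a`-piece of row `u`: the set of columns carrying the symbol `a` (CKSU's "puzzle pieces"
`{i : uᵢ = 1}`, `{i : uᵢ = 2}`, `{i : uᵢ = 3}`; AJX: "subrow for `e`").
[cite: CohnKleinbergSzegedyUmans2005, §3 (p. 5), puzzle interpretation] -/
def uspPiece (row : Fin s → Fin k → Fin 3) (a : Fin 3) (u : Fin s) : Finset (Fin k) :=
  univ.filter fun i => row u i = a

/-- Unfolding lemma for `uspPiece`. [folklore] -/
private theorem mem_uspPiece (row : Fin s → Fin k → Fin 3) (a : Fin 3) (u : Fin s) (i : Fin k) :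
    i ∈ uspPiece row a u ↔ row u i = a := by
  simp [uspPiece]

/-- The case analysis behind AJX Lemma 6: if the USP test passes at a cell where the transposition sits in
the slot of symbol `a` (coded `0/1/2`) and the identity in the other two slots, then the moved row shows
`a` at that cell and the fixed row does not. [folklore] -/
private theorem uspAtLeastTwo_swap_cases (x y : Fin 3) :
    (USPAtLeastTwo x y y → x = 0 ∧ y ≠ 0) ∧ (USPAtLeastTwo y x y → x = 1 ∧ y ≠ 1) ∧
      (USPAtLeastTwo y y x → x = 2 ∧ y ≠ 2) := by
  revert x y; decide

/-- Every symbol is `1`, `2` or `3` (coded `0, 1, 2`). [folklore] -/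
private theorem uspSymbol_cases (a : Fin 3) : a = 0 ∨ a = 1 ∨ a = 2 := by
  revert a; decide

/-- **Anderson–Ji–Xu 2020, Lemma 6 ("Implicit in [CKSU05]")**, AS PRINTED: "If `P` is a USP, then for
all `e ∈ [3]`, and distinct rows `r₁, r₂ ∈ P`, there is a column `c ∈ [k]` were one of the rows `r₁`
or `r₂` has an `e` and the other one does not." — i.e. for each symbol the piece map of a USP is
injective (= the step "letting `π₁` interchange them would violate the definition of a USP, and of
course the same holds for `2` or `3`" of CKSU Lemma 12).  Proof as printed: the transposition
`(r₁ r₂)` in the slot of `e`, identities in the other two slots.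
[cite: AndersonJiXu2020, Lemma 6 (arXiv:2301.00074v1 §3.5)]
[cite: CohnKleinbergSzegedyUmans2005, Lemma 12 (§3), proof] -/
theorem IsUSP.uspPiece_injective {row : Fin s → Fin k → Fin 3} (h : IsUSP row) (a : Fin 3) :
    Function.Injective (uspPiece row a) := by
  intro u v huv
  by_contra hne
  have hsw : Equiv.swap u v ≠ 1 := fun h1 => hne (Equiv.swap_eq_one_iff.mp h1)
  have hpiece : ∀ c, row u c = a ↔ row v c = a := fun c => by
    rw [← mem_uspPiece row a u c, ← mem_uspPiece row a v c, huv]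
  have hswap : ∀ r c, row (Equiv.swap u v r) c = a ↔ row r c = a := by
    intro r c
    rcases eq_or_ne r u with rfl | hru
    · rw [Equiv.swap_apply_left]; exact (hpiece c).symm
    rcases eq_or_ne r v with rfl | hrv
    · rw [Equiv.swap_apply_right]; exact hpiece c
    · rw [Equiv.swap_apply_of_ne_of_ne hru hrv]
  rcases uspSymbol_cases a with rfl | rfl | rfl
  · rcases h (Equiv.swap u v) 1 1 with ⟨h1, -⟩ | ⟨r, c, hx⟩
    · exact hsw h1
    · have hx' := (uspAtLeastTwo_swap_cases _ _).1 (by simpa using hx)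
      exact hx'.2 ((hswap r c).mp hx'.1)
  · rcases h 1 (Equiv.swap u v) 1 with ⟨h1, -⟩ | ⟨r, c, hx⟩
    · exact hsw h1.symm
    · have hx' := (uspAtLeastTwo_swap_cases _ _).2.1 (by simpa using hx)
      exact hx'.2 ((hswap r c).mp hx'.1)
  · rcases h 1 1 (Equiv.swap u v) with ⟨-, h2⟩ | ⟨r, c, hx⟩
    · exact hsw h2.symm
    · have hx' := (uspAtLeastTwo_swap_cases _ _).2.2 (by simpa using hx)
      exact hx'.2 ((hswap r c).mp hx'.1)

/-- A USP (as an indexed family) has pairwise distinct rows (equal rows have equal pieces; AJX Def. 1: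
"(s,k)-puzzle = set of s rows"). [cite: AndersonJiXu2020, Lemma 6 (arXiv:2301.00074v1 §3.5)] -/
theorem IsUSP.injective {row : Fin s → Fin k → Fin 3} (h : IsUSP row) : Function.Injective row := by
  intro u v huv
  exact h.uspPiece_injective 0 (by simp [uspPiece, huv])

/-- **The "unique pieces bound"** (Anderson–Ji–Xu 2020, §5: "Since that lemma requires that each row of a
(strong) USP have a unique ones, twos, and threes piece, the total number of rows in a strong USP cannot
be more than `2^k`"): a USP of width `k` has at most `2^k` rows.
[cite: AndersonJiXu2020, §5 'Unique Pieces Bound' (arXiv:2301.00074v1)] -/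
theorem IsUSP.card_le_two_pow {row : Fin s → Fin k → Fin 3} (h : IsUSP row) : s ≤ 2 ^ k := by
  classical
  have hc := Finset.card_le_card_of_injOn (s := (univ : Finset (Fin s)))
    (t := (univ : Finset (Finset (Fin k)))) (uspPiece row 0)
    (fun u _ => Finset.mem_coe.2 (Finset.mem_univ _)) ((h.uspPiece_injective 0).injOn)
  simpa [Finset.card_univ, Fintype.card_finset] using hc

/-- **The USP bound** as a function of the width (Anderson–Ji–Xu 2020, §5 Proposition 2; the finite
content of the proof of CKSU 2005 Lemma 3.2 / 12): `Σ_{c₁=0}^{k} Σ_{c₂=0}^{k−c₁} min(binom(k,c₁),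
binom(k,c₂), binom(k,k−(c₁+c₂)))`, written as one sum over the pairs `(c₁, c₂)` with `c₁ + c₂ ≤ k`.
[cite: AndersonJiXu2020, Proposition 2 (§5, arXiv:2301.00074v1)] -/
def uspSizeBound (k : ℕ) : ℕ :=
  ∑ p ∈ (range (k + 1) ×ˢ range (k + 1)).filter (fun p => p.1 + p.2 ≤ k),
    min (k.choose p.1) (min (k.choose p.2) (k.choose (k - (p.1 + p.2))))

/-- The USP bound for widths `1 … 12` evaluates to `3, 6, 12, 24, 45, 87, 168, 312, 597, 1140, 2112,
4023` — the 'USP' row of Anderson–Ji–Xu 2020, Table 2, verbatim.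
[cite: AndersonJiXu2020, Table 2 row 'USP' (arXiv:2301.00074v1 §7.1)] -/
theorem uspSizeBound_values :
    [uspSizeBound 1, uspSizeBound 2, uspSizeBound 3, uspSizeBound 4, uspSizeBound 5, uspSizeBound 6,
      uspSizeBound 7, uspSizeBound 8, uspSizeBound 9, uspSizeBound 10, uspSizeBound 11, uspSizeBound 12] =
      [3, 6, 12, 24, 45, 87, 168, 312, 597, 1140, 2112, 4023] := by
  decide +kernel

/-- The three pieces of a row partition the `k` columns: `|piece₀| + |piece₁| + |piece₂| = k`. [folklore] -/
private theorem card_uspPiece_sum (row : Fin s → Fin k → Fin 3) (u : Fin s) :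
    (uspPiece row 0 u).card + (uspPiece row 1 u).card + (uspPiece row 2 u).card = k := by
  classical
  have h := Finset.card_eq_sum_card_fiberwise (s := (univ : Finset (Fin k))) (t := (univ : Finset (Fin 3)))
    (f := row u) (fun i _ => Finset.mem_univ _)
  rw [Finset.card_univ, Fintype.card_fin, Fin.sum_univ_three] at h
  simpa [uspPiece, add_assoc] using h.symm

/-- **Anderson–Ji–Xu 2020, Proposition 2 (the finite core of CKSU 2005 Lemma 3.2 / 12)**, AS PRINTED:
"Let `P` be a `(s, k)`-USP, then `s ≤ Σ_{c₁=0}^{k} Σ_{c₂=0}^{k−c₁} min(binom(k,c₁), binom(k,c₂),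
binom(k, k−(c₁+c₂)))`".  Proof as in CKSU: split the rows by their piece sizes `(c₁, c₂)` (then the
`3`-piece has `k − (c₁ + c₂)` columns); within a class each of the three piece maps is injective
(`IsUSP.uspPiece_injective`) into the `cᵢ`-subsets of the `k` columns, so the class has at most
`minᵢ binom(k, cᵢ)` rows. [cite: AndersonJiXu2020, Proposition 2 (§5, arXiv:2301.00074v1)]
[cite: CohnKleinbergSzegedyUmans2005, Lemma 12 (§3), proof] -/
theorem IsUSP.card_le_uspSizeBound {row : Fin s → Fin k → Fin 3} (h : IsUSP row) :
    s ≤ uspSizeBound k := by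
  classical
  set S := (range (k + 1) ×ˢ range (k + 1)).filter (fun p : ℕ × ℕ => p.1 + p.2 ≤ k) with hS
  let f : Fin s → ℕ × ℕ := fun u => ((uspPiece row 0 u).card, (uspPiece row 1 u).card)
  have hsum := card_uspPiece_sum row
  have hf' : ∀ u, f u ∈ S := by
    intro u
    have hu := hsum u
    simp only [hS, Finset.mem_filter, Finset.mem_product, Finset.mem_range, f]
    omega
  have hf : Set.MapsTo f ((univ : Finset (Fin s)) : Set (Fin s)) (S : Set (ℕ × ℕ)) :=
    fun u _ => Finset.mem_coe.2 (hf' u)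
  -- each piece map sends a class into the subsets of the right size, injectively
  have hcls : ∀ p ∈ S, (univ.filter fun u => f u = p).card ≤
      min (k.choose p.1) (min (k.choose p.2) (k.choose (k - (p.1 + p.2)))) := by
    intro p hp
    have bound : ∀ (a : Fin 3) (n : ℕ), (∀ u, f u = p → (uspPiece row a u).card = n) →
        (univ.filter fun u => f u = p).card ≤ k.choose n := by
      intro a n hn
      have hc := Finset.card_le_card_of_injOn (uspPiece row a)
        (s := univ.filter fun u => f u = p) (t := powersetCard n (univ : Finset (Fin k)))
        (fun u hu =>
          Finset.mem_coe.2 (Finset.mem_powersetCard.2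
            ⟨Finset.subset_univ _, hn u (Finset.mem_filter.1 (Finset.mem_coe.1 hu)).2⟩))
        ((h.uspPiece_injective a).injOn)
      simpa [Finset.card_powersetCard] using hc
    refine le_min (bound 0 p.1 fun u hu => ?_) (le_min (bound 1 p.2 fun u hu => ?_)
      (bound 2 (k - (p.1 + p.2)) fun u hu => ?_))
    · exact congrArg Prod.fst hu
    · exact congrArg Prod.snd hu
    · have h1 : (uspPiece row 0 u).card = p.1 := congrArg Prod.fst hu
      have h2 : (uspPiece row 1 u).card = p.2 := congrArg Prod.snd hu
      have hu3 := hsum u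
      omega
  calc s = (univ : Finset (Fin s)).card := by simp
    _ = ∑ p ∈ S, (univ.filter fun u => f u = p).card := Finset.card_eq_sum_card_fiberwise hf
    _ ≤ ∑ p ∈ S, min (k.choose p.1) (min (k.choose p.2) (k.choose (k - (p.1 + p.2)))) :=
        Finset.sum_le_sum hcls
    _ = uspSizeBound k := by rw [uspSizeBound]

/-- The same bound for strong USPs (every strong USP is a USP); e.g. no strong USP of width `5` has more
than `45` rows, of width `6` more than `87` (the exhaustive maxima are `8` and `≥ 14`).
[cite: AndersonJiXu2020, Proposition 2 and Table 2 (§5, §7.1, arXiv:2301.00074v1)] -/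
theorem IsStrongUSP.card_le_uspSizeBound {row : Fin s → Fin k → Fin 3} (h : IsStrongUSP row) :
    s ≤ uspSizeBound k :=
  h.isUSP.card_le_uspSizeBound

end USPSize

/-! ## Subpuzzles: strong USPs (and USPs) are downward closed (Anderson–Ji–Xu 2020, Lemma 5) -/

section Downward

variable {s s' k : ℕ}

/-- Common core of AJX Lemma 5 for both puzzle notions: a permutation condition with a coordinate test `T`
that no constant triple passes descends from a puzzle to any injectively indexed subpuzzle — extend the three
permutations of the subpuzzle to the whole puzzle by the identity outside (`Equiv.Perm.extendDomain`); a
witness row outside the subpuzzle is fixed by all three extensions and would pass `T` with a constant triple.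
[folklore] -/
private theorem perm_test_restrict {T : Fin 3 → Fin 3 → Fin 3 → Prop} (hT : ∀ x, ¬ T x x x)
    {row : Fin s → Fin k → Fin 3}
    (h : ∀ π₁ π₂ π₃ : Perm (Fin s), (π₁ = π₂ ∧ π₂ = π₃) ∨
      ∃ u : Fin s, ∃ i : Fin k, T (row (π₁ u) i) (row (π₂ u) i) (row (π₃ u) i))
    (e : Fin s' → Fin s) (he : Function.Injective e) (π₁ π₂ π₃ : Perm (Fin s')) :
    (π₁ = π₂ ∧ π₂ = π₃) ∨
      ∃ u : Fin s', ∃ i : Fin k, T (row (e (π₁ u)) i) (row (e (π₂ u)) i) (row (e (π₃ u)) i) := by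
  classical
  let f : Fin s' ≃ Set.range e := Equiv.ofInjective e he
  have hf : ∀ a, ((f a : Set.range e) : Fin s) = e a := fun a => rfl
  rcases h (π₁.extendDomain f) (π₂.extendDomain f) (π₃.extendDomain f) with ⟨h12, h23⟩ | ⟨r, i, hr⟩
  · left
    have hinj := Equiv.Perm.extendDomainHom_injective f
    exact ⟨hinj (by simpa using h12), hinj (by simpa using h23)⟩
  · by_cases hmem : r ∈ Set.range e
    · obtain ⟨u, rfl⟩ : ∃ u, e u = r := hmem
      refine Or.inr ⟨u, i, ?_⟩
      have key : ∀ π : Perm (Fin s'), (π.extendDomain f) (e u) = e (π u) := fun π => by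
        rw [← hf u, Equiv.Perm.extendDomain_apply_image, hf]
      rwa [key, key, key] at hr
    · rw [Equiv.Perm.extendDomain_apply_not_subtype _ _ hmem,
        Equiv.Perm.extendDomain_apply_not_subtype _ _ hmem,
        Equiv.Perm.extendDomain_apply_not_subtype _ _ hmem] at hr
      exact absurd hr (hT _)

/-- No symbol satisfies "at least two of `x = 1`, `x = 2`, `x = 3`". [folklore] -/
private theorem not_uspAtLeastTwo_self (x : Fin 3) : ¬ USPAtLeastTwo x x x := by
  revert x; decide

/-- **Anderson–Ji–Xu 2020, Lemma 5** (AS PRINTED: "If `P` is a strong USP, then so is every subpuzzle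
`P′ ⊆ P`."), for subpuzzles given by an injective re-indexing `e` of rows: proof as printed ("Consider
restricting the permutations to those that fix the elements of `P ∖ P′`. For these permutations it must be
the case that `r ∈ P′` because otherwise … there is exactly one `j ∈ [3]` for which `(π_j(r))ᵢ = j` holds").
[cite: AndersonJiXu2020, Lemma 5 (arXiv:2301.00074v1 §3.5 'Downward Closure')] -/
theorem IsStrongUSP.restrict {row : Fin s → Fin k → Fin 3} (h : IsStrongUSP row) (e : Fin s' → Fin s)
    (he : Function.Injective e) : IsStrongUSP (fun u i => row (e u) i) :=
  fun π₁ π₂ π₃ => perm_test_restrict not_uspExactlyTwo_self h e he π₁ π₂ π₃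

/-- The same for USPs: every subpuzzle of a USP is a USP (same proof; implicit in CKSU 2005 §3 /
Anderson–Ji–Xu 2020 §3.5). [cite: AndersonJiXu2020, Lemma 5 (arXiv:2301.00074v1 §3.5), proof] -/
theorem IsUSP.restrict {row : Fin s → Fin k → Fin 3} (h : IsUSP row) (e : Fin s' → Fin s)
    (he : Function.Injective e) : IsUSP (fun u i => row (e u) i) :=
  fun π₁ π₂ π₃ => perm_test_restrict not_uspAtLeastTwo_self h e he π₁ π₂ π₃

/-- In particular the maximum size of a strong USP of width `k` is monotone under taking subpuzzles: if some
`s`-row strong USP of width `k` exists then so does an `s'`-row one for every `s' ≤ s` (restrict to the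
first `s'` rows). [cite: AndersonJiXu2020, Lemma 5 (arXiv:2301.00074v1 §3.5)] -/
theorem IsStrongUSP.exists_of_le {row : Fin s → Fin k → Fin 3} (h : IsStrongUSP row) {s' : ℕ}
    (hs : s' ≤ s) : ∃ row' : Fin s' → Fin k → Fin 3, IsStrongUSP row' :=
  ⟨_, h.restrict (Fin.castLE hs) (Fin.castLE_injective hs)⟩

end Downward

section TwoSymbols

/-! ### Two symbols per coordinate (CKSU 2005, §3.4, opening paragraph)

"The strong USP constructed in Proposition 3.1 has the property that only two symbols (of the three
possibilities `1`, `2`, and `3`) occur in each coordinate. Every USP with this property is a strong USP" —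
because the three conditions `(π₁u)ᵢ = 1`, `(π₂u)ᵢ = 2`, `(π₃u)ᵢ = 3` cannot hold simultaneously in a column
missing one of the symbols, so "at least two" is "exactly two". -/

/-- Case check on `Fin 3`: "at least two" plus a missing symbol gives "exactly two". [folklore] -/
private theorem uspExactlyTwo_of_atLeastTwo_of_ne :
    ∀ x y z c : Fin 3, USPAtLeastTwo x y z → x ≠ c → y ≠ c → z ≠ c → USPExactlyTwo x y z := by
  decide

/-- "Every USP in which only two symbols occur in each coordinate is a strong USP" (CKSU 2005, §3.4, first
paragraph): if every column of the puzzle misses at least one of the three symbols, `IsUSP row → IsStrongUSP row`.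
[cite: CohnKleinbergSzegedyUmans2005, §3.4 (p. 6), sentence before Lemma 17] -/
theorem IsUSP.isStrongUSP_of_twoSymbols {s k : ℕ} {row : Fin s → Fin k → Fin 3} (h : IsUSP row)
    (h2 : ∀ i : Fin k, ∃ c : Fin 3, ∀ u : Fin s, row u i ≠ c) : IsStrongUSP row := by
  intro π₁ π₂ π₃
  rcases h π₁ π₂ π₃ with hall | ⟨u, i, hu⟩
  · exact Or.inl hall
  · refine Or.inr ⟨u, i, ?_⟩
    obtain ⟨c, hc⟩ := h2 i
    exact uspExactlyTwo_of_atLeastTwo_of_ne _ _ _ c hu (hc _) (hc _) (hc _)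

end TwoSymbols

/-! ## Puzzle symmetry: rows, columns and symbols (Anderson–Ji–Xu 2020, §4.1, Lemma 8)

"Since puzzles are defined as sets of rows, the ordering of the rows of a puzzle `P` does not affect the SUSP
property. Similarly, but slightly less obviously, the SUSP property is invariant to reordering the columns of
the puzzle … Lastly, the alphabet `[3]` typically used to represent the elements of a puzzle is completely
arbitrary … **Lemma 8.** Let `ρ ∈ Sym([k])`, `δ ∈ Sym([3])`. An `(s,k)`-puzzle `P` is a strong USP iff
`{(δ(r_{ρ(c)}))_{c ∈ [k]} | r ∈ P}` is a strong USP.  *Proof.* Follows immediately from Definition 1 and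
Definition 3." (arXiv:2301.00074v1 §4.1).  The one step that is not literally immediate is the symbol
relabelling: the condition "exactly two of `δ((π₁u)ᵢ) = 1, δ((π₂u)ᵢ) = 2, δ((π₃u)ᵢ) = 3`" is the condition
"exactly two of `(π'₁u)ᵢ = 1, (π'₂u)ᵢ = 2, (π'₃u)ᵢ = 3`" for the RE-SLOTTED triple `π'_a = π_{δ⁻¹(a)}`
(`uspExactlyTwo_reslot`), and `π'₁ = π'₂ = π'₃ ↔ π₁ = π₂ = π₃`.  These are the symmetries
`Sym(rows) × Sym([k]) × Sym([3])` modulo which Anderson–Ji–Xu count "equivalence classes" of SUSPs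
(their Table 3) and under which orderly-generation certificates for maximal sizes are quotiented. -/

section Symmetry

variable {s k : ℕ}

/-- Re-slotting of the coordinate predicate under a symbol permutation `δ`: "exactly two of
`δ x₀ = 1, δ x₁ = 2, δ x₂ = 3`" iff "exactly two of `x_{δ(1)} = 1, x_{δ(2)} = 2, x_{δ(3)} = 3`" (the same three
conditions, listed in the order `b ↦ δ b`; `6 · 27` cases). [folklore] -/
private theorem uspExactlyTwo_reslot :
    ∀ (δ : Perm (Fin 3)) (x₀ x₁ x₂ : Fin 3),
      USPExactlyTwo (δ x₀) (δ x₁) (δ x₂) ↔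
        USPExactlyTwo (![x₀, x₁, x₂] (δ 0)) (![x₀, x₁, x₂] (δ 1)) (![x₀, x₁, x₂] (δ 2)) := by
  decide

/-- The same re-slotting for "at least two". [folklore] -/
private theorem uspAtLeastTwo_reslot :
    ∀ (δ : Perm (Fin 3)) (x₀ x₁ x₂ : Fin 3),
      USPAtLeastTwo (δ x₀) (δ x₁) (δ x₂) ↔
        USPAtLeastTwo (![x₀, x₁, x₂] (δ 0)) (![x₀, x₁, x₂] (δ 1)) (![x₀, x₁, x₂] (δ 2)) := by
  decide

/-- Common core of the symbol part of AJX Lemma 8 for both puzzle notions: a permutation condition with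
coordinate test `T` that re-slots under `δ` transfers from the relabelled puzzle `δ ∘ row` to `row`. [folklore] -/
private theorem perm_test_of_symbolPerm {T : Fin 3 → Fin 3 → Fin 3 → Prop}
    (hT : ∀ (δ : Perm (Fin 3)) (x₀ x₁ x₂ : Fin 3), T (δ x₀) (δ x₁) (δ x₂) ↔
      T (![x₀, x₁, x₂] (δ 0)) (![x₀, x₁, x₂] (δ 1)) (![x₀, x₁, x₂] (δ 2)))
    (δ : Perm (Fin 3)) {row : Fin s → Fin k → Fin 3}
    (h : ∀ π₁ π₂ π₃ : Perm (Fin s), (π₁ = π₂ ∧ π₂ = π₃) ∨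
      ∃ u : Fin s, ∃ i : Fin k, T (δ (row (π₁ u) i)) (δ (row (π₂ u) i)) (δ (row (π₃ u) i))) :
    ∀ π₁ π₂ π₃ : Perm (Fin s), (π₁ = π₂ ∧ π₂ = π₃) ∨
      ∃ u : Fin s, ∃ i : Fin k, T (row (π₁ u) i) (row (π₂ u) i) (row (π₃ u) i) := by
  intro π₁ π₂ π₃
  -- the re-slotted triple `π'_a = π_{δ⁻¹ a}`
  let πv : Fin 3 → Perm (Fin s) := ![π₁, π₂, π₃]
  have hπv : ∀ b : Fin 3, ![πv (δ.symm 0), πv (δ.symm 1), πv (δ.symm 2)] (δ b) = πv b := by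
    intro b
    generalize hc : δ b = c
    have hb : b = δ.symm c := by rw [← hc, Equiv.symm_apply_apply]
    subst hb
    fin_cases c <;> rfl
  rcases h (πv (δ.symm 0)) (πv (δ.symm 1)) (πv (δ.symm 2)) with ⟨h01, h12⟩ | ⟨u, i, hx⟩
  · left
    have hall : ∀ c : Fin 3, ![πv (δ.symm 0), πv (δ.symm 1), πv (δ.symm 2)] c = πv (δ.symm 0) := by
      intro c
      fin_cases c
      · rfl
      · exact h01.symm
      · exact (h01.trans h12).symm
    have key : ∀ b : Fin 3, πv b = πv (δ.symm 0) := fun b => by rw [← hπv b]; exact hall (δ b)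
    have e0 : πv 0 = π₁ := rfl
    have e1 : πv 1 = π₂ := rfl
    have e2 : πv 2 = π₃ := rfl
    refine ⟨?_, ?_⟩
    · rw [← e0, ← e1, key 0, key 1]
    · rw [← e1, ← e2, key 1, key 2]
  · right
    refine ⟨u, i, ?_⟩
    have hx' := (hT δ (row (πv (δ.symm 0) u) i) (row (πv (δ.symm 1) u) i) (row (πv (δ.symm 2) u) i)).1 hx
    have hrow : ∀ b : Fin 3, ![row (πv (δ.symm 0) u) i, row (πv (δ.symm 1) u) i, row (πv (δ.symm 2) u) i] (δ b)
        = row (πv b u) i := by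
      intro b
      generalize hc : δ b = c
      have hb : b = δ.symm c := by rw [← hc, Equiv.symm_apply_apply]
      subst hb
      fin_cases c <;> rfl
    rw [hrow 0, hrow 1, hrow 2] at hx'
    exact hx'

/-- **Symbol relabelling (the `δ ∈ Sym([3])` part of AJX Lemma 8):** relabelling the three symbols by a
permutation `δ` does not change strong-USP-ness. [cite: AndersonJiXu2020, Lemma 8 (arXiv:2301.00074v1 §4.1)] -/
theorem isStrongUSP_symbolPerm_iff (δ : Perm (Fin 3)) (row : Fin s → Fin k → Fin 3) :
    IsStrongUSP (fun u i => δ (row u i)) ↔ IsStrongUSP row := by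
  constructor
  · exact fun h => perm_test_of_symbolPerm uspExactlyTwo_reslot δ h
  · intro h
    have h' : IsStrongUSP (fun u i => δ.symm (δ (row u i))) := by
      simpa only [Equiv.symm_apply_apply] using h
    exact perm_test_of_symbolPerm uspExactlyTwo_reslot δ.symm (row := fun u i => δ (row u i)) h'

/-- Symbol relabelling does not change USP-ness either (same argument with "at least two").
[cite: AndersonJiXu2020, Lemma 8 (arXiv:2301.00074v1 §4.1), proof] -/
theorem isUSP_symbolPerm_iff (δ : Perm (Fin 3)) (row : Fin s → Fin k → Fin 3) :
    IsUSP (fun u i => δ (row u i)) ↔ IsUSP row := by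
  constructor
  · exact fun h => perm_test_of_symbolPerm uspAtLeastTwo_reslot δ h
  · intro h
    have h' : IsUSP (fun u i => δ.symm (δ (row u i))) := by
      simpa only [Equiv.symm_apply_apply] using h
    exact perm_test_of_symbolPerm uspAtLeastTwo_reslot δ.symm (row := fun u i => δ (row u i)) h'

/-- **Column reordering (the `ρ ∈ Sym([k])` part of AJX Lemma 8):** "the required existential condition
`∃ c ∈ [k] st. (…)` … is independent of the ordering of the columns".
[cite: AndersonJiXu2020, Lemma 8 (arXiv:2301.00074v1 §4.1)] -/
theorem isStrongUSP_colPerm_iff (ρ : Perm (Fin k)) (row : Fin s → Fin k → Fin 3) :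
    IsStrongUSP (fun u c => row u (ρ c)) ↔ IsStrongUSP row := by
  constructor
  · intro h π₁ π₂ π₃
    rcases h π₁ π₂ π₃ with hall | ⟨u, c, hx⟩
    · exact Or.inl hall
    · exact Or.inr ⟨u, ρ c, hx⟩
  · intro h π₁ π₂ π₃
    rcases h π₁ π₂ π₃ with hall | ⟨u, c, hx⟩
    · exact Or.inl hall
    · exact Or.inr ⟨u, ρ.symm c, by simpa only [Equiv.apply_symm_apply] using hx⟩

/-- Column reordering does not change USP-ness. [cite: AndersonJiXu2020, Lemma 8 (arXiv:2301.00074v1 §4.1), proof] -/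
theorem isUSP_colPerm_iff (ρ : Perm (Fin k)) (row : Fin s → Fin k → Fin 3) :
    IsUSP (fun u c => row u (ρ c)) ↔ IsUSP row := by
  constructor
  · intro h π₁ π₂ π₃
    rcases h π₁ π₂ π₃ with hall | ⟨u, c, hx⟩
    · exact Or.inl hall
    · exact Or.inr ⟨u, ρ c, hx⟩
  · intro h π₁ π₂ π₃
    rcases h π₁ π₂ π₃ with hall | ⟨u, c, hx⟩
    · exact Or.inl hall
    · exact Or.inr ⟨u, ρ.symm c, by simpa only [Equiv.apply_symm_apply] using hx⟩

/-- **Row reordering:** "Since puzzles are defined as sets of rows, the ordering of the rows of a puzzle `P`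
does not affect the SUSP property" — re-indexing the rows along a permutation (a special case of
`IsStrongUSP.restrict`). [cite: AndersonJiXu2020, §4.1 (arXiv:2301.00074v1), first sentence] -/
theorem isStrongUSP_rowPerm_iff (e : Perm (Fin s)) (row : Fin s → Fin k → Fin 3) :
    IsStrongUSP (fun u i => row (e u) i) ↔ IsStrongUSP row := by
  refine ⟨fun h => ?_, fun h => h.restrict e e.injective⟩
  have h' := h.restrict e.symm e.symm.injective
  simpa only [Equiv.apply_symm_apply] using h'

/-- Row reordering does not change USP-ness. [cite: AndersonJiXu2020, §4.1 (arXiv:2301.00074v1), first sentence] -/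
theorem isUSP_rowPerm_iff (e : Perm (Fin s)) (row : Fin s → Fin k → Fin 3) :
    IsUSP (fun u i => row (e u) i) ↔ IsUSP row := by
  refine ⟨fun h => ?_, fun h => h.restrict e e.injective⟩
  have h' := h.restrict e.symm e.symm.injective
  simpa only [Equiv.apply_symm_apply] using h'

/-- **Anderson–Ji–Xu 2020, Lemma 8, AS PRINTED:** "Let `ρ ∈ Sym([k])`, `δ ∈ Sym([3])`. An `(s,k)`-puzzle
`P` is a strong USP iff `{(δ(r_{ρ(c)}))_{c ∈ [k]} | r ∈ P}` is a strong USP."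
[cite: AndersonJiXu2020, Lemma 8 (arXiv:2301.00074v1 §4.1 'Puzzle Symmetry')] -/
theorem AndersonJiXu2020_lemma8 (ρ : Perm (Fin k)) (δ : Perm (Fin 3)) (row : Fin s → Fin k → Fin 3) :
    IsStrongUSP row ↔ IsStrongUSP (fun u c => δ (row u (ρ c))) := by
  rw [isStrongUSP_symbolPerm_iff δ (fun u c => row u (ρ c)), isStrongUSP_colPerm_iff]

/-- The full symmetry group `Sym(rows) × Sym([k]) × Sym([3])` at once: a puzzle is a strong USP iff its image
under any row reordering `e`, column reordering `ρ` and symbol relabelling `δ` is.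
[cite: AndersonJiXu2020, Lemma 8 and §4.1 (arXiv:2301.00074v1)] -/
theorem isStrongUSP_relabel_iff (e : Perm (Fin s)) (ρ : Perm (Fin k)) (δ : Perm (Fin 3))
    (row : Fin s → Fin k → Fin 3) :
    IsStrongUSP (fun u c => δ (row (e u) (ρ c))) ↔ IsStrongUSP row := by
  rw [isStrongUSP_symbolPerm_iff δ (fun u c => row (e u) (ρ c)),
    isStrongUSP_colPerm_iff ρ (fun u c => row (e u) c), isStrongUSP_rowPerm_iff]

end Symmetry

end Literature.Computability.AlgebraicComplexity
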